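import Summits.CriticalPhenomena.PercolationContinuityZ3.Theorems.PercNearOneGluingNoHeavyLowerTailSunflowerRainbowVectors
import Mathlib.LinearAlgebra.Dimension.Constructions
import Mathlib.LinearAlgebra.Dimension.StrongRankCondition
import Mathlib.LinearAlgebra.Matrix.ToLin
import Mathlib.LinearAlgebra.Matrix.Rank
import HarnessLib
import HarnessLib.Audit

/-!
# `NoHeavyLowerTail` (crux stmt-CriticalPhenomena-4575), abstract sunflower cubic: ★ (`PartitionLemmaH`) REDUCED TO THE LINEAR INDEPENDENCE OF
# AN EXPLICIT FAMILY OF GF(2) VECTORS, part B — `rbVec_orth`, the typed conjecture `RainbowKernelIndependence`, and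
# `partitionLemmaH_of_rainbowKernelIndependence`

Support file (seat `prim-l12-p2` gen 18; `--supports stmt-CriticalPhenomena-4575`).  No `sorry`.  The `@[conjecture]` definition is an obligation of
this programme (census-true, unproved), never a fact — it is used only as an explicit hypothesis.
Memo: run/shared/lean/prim/prim-l12/prim-l12-p2/FINDING-g18-CUBE-GLADKOV-RANK.md §8.  Setting, vectors and `specRows_indep`: part A (`…SunflowerRainbowVectors`).

* `Sunflower.rbVec_orth` — every two-stage rainbow vector is orthogonal to every spectator row (kernel lemmas `nu_mem_ker` / `mu_mem_ker`).
* `RainbowKernelIndependence` (typed conjecture; census: n ≤ 4 and n = 5 EXHAUSTIVE — kit j132962: all 275 665 902 monotone maps `2^5 → M₃`,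
  2 890 800 with rainbows, 0 exceptions —, 8·10⁴ random sunflowers on 6 points, doubled star, perturbed co-products and three-hub families on
  7–8 points: 0 exceptions): for every sunflower the vectors `rbVec ρ ∈ GF(2)^{sup}` (`ρ` a rainbow) are linearly independent.
* `partitionLemmaH_of_rainbowKernelIndependence : RainbowKernelIndependence → PartitionLemmaH` — rank–nullity in `GF(2)^{sup}`: the
  spectator-row map has rank `#{non-rainbow demands}` (`specRows_indep`, via `Matrix.rank_transpose`), the span of the rainbow vectors has
  dimension `#{rainbows}` and lies in its kernel; hence `#dem ≤ #sup`, i.e. `0 ≤ ZH = 6(#sup − #dem)`.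
So ★ — and with it `H_{q+t}`, `γ`, `G₄`, `AG⁺` for every product measure (prove-1's cloning reduction) — now rests on ONE explicit statement of
linear algebra over `GF(2)`.
-/

namespace Summit.CriticalPhenomena.PercolationContinuityZ3.Theorems.SunflowerPartition

open Finset

namespace Sunflower

variable {α : Type*} [Fintype α] [DecidableEq α] (F : Sunflower α)

/-! ## The rainbow vectors are orthogonal to the spectator rows -/

/-- `((Sᶜ ∖ O) ∪ S)ᶜ = O` for `O ⊆ Sᶜ`. [folklore] -/
theorem third_of_mk {S O : Finset α} (hO : O ⊆ Sᶜ) : ((Sᶜ \ O) ∪ S)ᶜ = O := by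
  ext x; simp only [mem_compl, mem_union, mem_sdiff, not_or, not_and, not_not]
  constructor
  · rintro ⟨h1, h2⟩; exact h1 h2
  · intro hx; exact ⟨fun _ => hx, fun hxS => (mem_compl.1 (hO hx)) hxS⟩

/-- Sums over the supplies with a fixed spectator block `S`, reindexed by the bottom block `O ⊆ Sᶜ`. [this work] -/
theorem sum_sup_spectator (S : Finset α) (hS : F.lab S = 4 ∨ F.lab S = 0) (g : Finset α × Finset α → ZMod 2) :
    (∑ σ ∈ F.sup, (if σ.2 = S then g σ else 0))
      = ∑ O ∈ (Sᶜ).powerset.filter (fun O => F.lab O = 0 ∧ F.lab (Sᶜ \ O) = 4), g (Sᶜ \ O, S) := by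
  rw [← Finset.sum_filter]
  refine Finset.sum_bij' (fun σ _ => (σ.1 ∪ σ.2)ᶜ) (fun O _ => (Sᶜ \ O, S)) ?_ ?_ ?_ ?_ ?_
  · intro σ hσ
    obtain ⟨hσs, hσS⟩ := mem_filter.1 hσ
    obtain ⟨hdisj, h4, -, h0⟩ := F.sup_facts hσs
    have e : Sᶜ \ (σ.1 ∪ σ.2)ᶜ = σ.1 := by rw [← hσS, union_comm]; exact compl_sdiff_third hdisj.symm
    refine mem_filter.2 ⟨mem_powerset.2 ?_, h0, by rw [e]; exact h4⟩
    rw [← hσS, union_comm]; exact third_subset_compl σ.2 σ.1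
  · intro O hO
    obtain ⟨hOW, hO0, hO4⟩ := mem_filter.1 hO
    exact mem_filter.2 ⟨F.mk_mem_sup (mem_powerset.1 hOW) hS hO0 hO4, rfl⟩
  · intro σ hσ
    obtain ⟨hσs, hσS⟩ := mem_filter.1 hσ
    obtain ⟨hdisj, -⟩ := F.sup_facts hσs
    have e : Sᶜ \ (σ.1 ∪ σ.2)ᶜ = σ.1 := by rw [← hσS, union_comm]; exact compl_sdiff_third hdisj.symm
    rw [e]; rcases σ with ⟨a, b⟩; simp only at hσS ⊢; rw [hσS]
  · intro O hO
    exact third_of_mk (mem_powerset.1 (mem_filter.1 hO).1)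
  · intro σ hσ
    obtain ⟨hσs, hσS⟩ := mem_filter.1 hσ
    obtain ⟨hdisj, -⟩ := F.sup_facts hσs
    have e : Sᶜ \ (σ.1 ∪ σ.2)ᶜ = σ.1 := by rw [← hσS, union_comm]; exact compl_sdiff_third hdisj.symm
    have : (Sᶜ \ (σ.1 ∪ σ.2)ᶜ, S) = σ := by rw [e]; rcases σ with ⟨a, b⟩; simp only at hσS ⊢; rw [hσS]
    rw [this]

/-- **The rainbow vectors lie in the kernel of every spectator row** (this work): `Σ_σ specRow d σ · rbVec ρ σ = 0` for every
non-rainbow demand `d` and rainbow `ρ` — on a bottom cube only `TS-B` is present and `nu_mem_ker` applies, on a kernel cube only `TS-A` and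
`mu_mem_ker` applies. [this work] -/
theorem rbVec_orth {ρ d : Finset α × Finset α} (hρ : ρ ∈ F.dem) (hr : F.IsRainbow ρ) (hd : d ∈ F.dem) (hnr : ¬ F.IsRainbow d) :
    (∑ σ ∈ F.sup, F.specRow d σ * F.rbVec ρ σ) = 0 := by
  obtain ⟨hdisj, hS, hX0, hX4, hY0, hY4, hlt⟩ := F.dem_spec_facts hd hnr
  obtain ⟨-, hQ1, -, hQ3⟩ := F.dem_rainbow_facts hρ hr
  have hXd : d.1ᶜ \ (d.1 ∪ d.2)ᶜ = d.2 := compl_sdiff_third hdisj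
  have hYW : (d.1 ∪ d.2)ᶜ ⊆ d.1ᶜ := third_subset_compl d.1 d.2
  have hY1 : F.lab (d.1 ∪ d.2)ᶜ ≠ 1 := by
    rcases petal_lt_cases _ _ hX0 hX4 hY0 hY4 hlt with ⟨-, h | h⟩ | ⟨-, h⟩ <;> rw [h] <;> decide
  have hX3 : F.lab d.2 ≠ 3 := by
    rcases petal_lt_cases _ _ hX0 hX4 hY0 hY4 hlt with ⟨h, -⟩ | ⟨h, -⟩ <;> rw [h] <;> decide
  -- only the supplies with spectator `d.1` contribute
  rw [show (∑ σ ∈ F.sup, F.specRow d σ * F.rbVec ρ σ) = ∑ σ ∈ F.sup, (if σ.2 = d.1 then F.specRow d σ * F.rbVec ρ σ else 0) from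
    sum_congr rfl fun σ _ => by
      by_cases h : σ.2 = d.1
      · rw [if_pos h]
      · unfold specRow; rw [if_neg h, zero_mul, if_neg h]]
  rw [F.sum_sup_spectator d.1 hS.symm]
  rcases hS with hS0 | hS4
  · -- bottom spectator: `specRow = M(Y_d, O)`, `rbVec = TS-B = [cond]·Φ_B(S,Q3)·ν_{Q1}(O)`
    by_cases hcond : F.lab d.1 = 0 ∧ d.1 ⊆ (ρ.1 ∪ ρ.2)ᶜ ∧ F.lab (d.1ᶜ \ ρ.1) = 4
    · have hPW : ρ.1 ⊆ d.1ᶜ := by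
        intro x hx; rw [mem_compl]; intro hxS
        have := hcond.2.1 hxS; rw [mem_compl, mem_union, not_or] at this; exact this.1 hx
      have key := F.nu_mem_ker d.1ᶜ hYW hPW hY4 (by rw [hXd]; exact hX4) hY1 hQ1 hcond.2.2
      rw [← Finset.sum_filter_add_sum_filter_not (d.1ᶜ).powerset (fun O => F.lab O = 0 ∧ F.lab (d.1ᶜ \ O) = 4)] at key
      rw [show (∑ O ∈ (d.1ᶜ).powerset.filter (fun O => ¬ (F.lab O = 0 ∧ F.lab (d.1ᶜ \ O) = 4)),
            (∑ R' ∈ (d.1ᶜ).powerset, (if F.lab R' = 0 ∧ O ⊆ R' ∧ R' ⊆ (d.1 ∪ d.2)ᶜ then (1 : ZMod 2) else 0)) *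
            (∑ R ∈ (d.1ᶜ).powerset, (if F.lab R = 4 ∧ ρ.1 ⊆ R ∧ R ⊆ d.1ᶜ \ O then (1 : ZMod 2) else 0))) = 0 from
          sum_eq_zero fun O hO => by
            have hO' := (mem_filter.1 hO).2
            by_cases h0 : F.lab O = 0
            · have h4 : F.lab (d.1ᶜ \ O) ≠ 4 := fun h => hO' ⟨h0, h⟩
              rw [show (∑ R ∈ (d.1ᶜ).powerset, (if F.lab R = 4 ∧ ρ.1 ⊆ R ∧ R ⊆ d.1ᶜ \ O then (1 : ZMod 2) else 0)) = 0 from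
                sum_eq_zero fun R _ => if_neg fun h' => h4 (F.lab_eq_four_of_subset h'.2.2 h'.1), mul_zero]
            · rw [F.crossM_eq_zero_of_lab_ne d.1ᶜ h0, zero_mul], add_zero] at key
      rw [show (∑ O ∈ (d.1ᶜ).powerset.filter (fun O => F.lab O = 0 ∧ F.lab (d.1ᶜ \ O) = 4),
              F.specRow d (d.1ᶜ \ O, d.1) * F.rbVec ρ (d.1ᶜ \ O, d.1))
          = (∑ R' ∈ (Finset.univ : Finset α).powerset, (if F.lab R' = 0 ∧ d.1 ⊆ R' ∧ R' ⊆ (ρ.1 ∪ ρ.2)ᶜ then (1 : ZMod 2) else 0)) *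
            (∑ O ∈ (d.1ᶜ).powerset.filter (fun O => F.lab O = 0 ∧ F.lab (d.1ᶜ \ O) = 4),
              (∑ R' ∈ (d.1ᶜ).powerset, (if F.lab R' = 0 ∧ O ⊆ R' ∧ R' ⊆ (d.1 ∪ d.2)ᶜ then (1 : ZMod 2) else 0)) *
              (∑ R ∈ (d.1ᶜ).powerset, (if F.lab R = 4 ∧ ρ.1 ⊆ R ∧ R ⊆ d.1ᶜ \ O then (1 : ZMod 2) else 0))) from ?_]
      · rw [key, mul_zero]
      rw [Finset.mul_sum]
      refine sum_congr rfl fun O hO => ?_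
      have hOW : O ⊆ d.1ᶜ := mem_powerset.1 (mem_filter.1 hO).1
      have h3 : ((d.1ᶜ \ O) ∪ d.1)ᶜ = O := third_of_mk hOW
      unfold specRow rbVec
      simp only
      rw [if_true, if_pos hS0, h3, if_pos hcond, if_neg (fun h => by rw [hS0] at h; exact absurd h.1 (by decide)), add_zero]
      ring
    · refine sum_eq_zero fun O _ => ?_
      unfold rbVec
      simp only
      rw [if_neg hcond, if_neg (fun h => by rw [hS0] at h; exact absurd h.1 (by decide)), add_zero, mul_zero]
  · -- kernel spectator: `specRow = N(O, Y_d)`, `rbVec = TS-A = [cond]·Φ_A(Q1,S)·μ_{Q3}(O)`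
    have hS0 : F.lab d.1 ≠ 0 := by rw [hS4]; decide
    by_cases hcond : F.lab d.1 = 4 ∧ ρ.1 ⊆ d.1 ∧ (ρ.1 ∪ ρ.2)ᶜ ⊆ d.1ᶜ ∧ F.lab (d.1ᶜ \ (ρ.1 ∪ ρ.2)ᶜ) = 0
    · have key := F.mu_mem_ker d.1ᶜ hYW hcond.2.2.1 hY0 (by rw [hXd]; exact hX0) (by rw [hXd]; exact hX4)
        (by rw [hXd]; exact hX3) hQ3 hcond.2.2.2
      rw [← Finset.sum_filter_add_sum_filter_not (d.1ᶜ).powerset (fun O => F.lab O = 0 ∧ F.lab (d.1ᶜ \ O) = 4)] at key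
      rw [show (∑ O ∈ (d.1ᶜ).powerset.filter (fun O => ¬ (F.lab O = 0 ∧ F.lab (d.1ᶜ \ O) = 4)),
            (∑ R' ∈ (d.1ᶜ).powerset, (if F.lab R' = 0 ∧ O ⊆ R' ∧ R' ⊆ (ρ.1 ∪ ρ.2)ᶜ then (1 : ZMod 2) else 0)) *
            (∑ R ∈ (d.1ᶜ).powerset, (if F.lab R = 4 ∧ d.1ᶜ \ (d.1 ∪ d.2)ᶜ ⊆ R ∧ R ⊆ d.1ᶜ \ O then (1 : ZMod 2) else 0))) = 0 from
          sum_eq_zero fun O hO => by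
            have hO' := (mem_filter.1 hO).2
            by_cases h0 : F.lab O = 0
            · have h4 : F.lab (d.1ᶜ \ O) ≠ 4 := fun h => hO' ⟨h0, h⟩
              rw [F.crossN_eq_zero_of_lab_ne d.1ᶜ h4, mul_zero]
            · rw [F.crossM_eq_zero_of_lab_ne d.1ᶜ h0, zero_mul], add_zero] at key
      rw [show (∑ O ∈ (d.1ᶜ).powerset.filter (fun O => F.lab O = 0 ∧ F.lab (d.1ᶜ \ O) = 4),
              F.specRow d (d.1ᶜ \ O, d.1) * F.rbVec ρ (d.1ᶜ \ O, d.1))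
          = (∑ R ∈ (Finset.univ : Finset α).powerset, (if F.lab R = 4 ∧ ρ.1 ⊆ R ∧ R ⊆ d.1 then (1 : ZMod 2) else 0)) *
            (∑ O ∈ (d.1ᶜ).powerset.filter (fun O => F.lab O = 0 ∧ F.lab (d.1ᶜ \ O) = 4),
              (∑ R' ∈ (d.1ᶜ).powerset, (if F.lab R' = 0 ∧ O ⊆ R' ∧ R' ⊆ (ρ.1 ∪ ρ.2)ᶜ then (1 : ZMod 2) else 0)) *
              (∑ R ∈ (d.1ᶜ).powerset, (if F.lab R = 4 ∧ d.1ᶜ \ (d.1 ∪ d.2)ᶜ ⊆ R ∧ R ⊆ d.1ᶜ \ O then (1 : ZMod 2) else 0))) from ?_]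
      · rw [key, mul_zero]
      rw [Finset.mul_sum]
      refine sum_congr rfl fun O hO => ?_
      have hOW : O ⊆ d.1ᶜ := mem_powerset.1 (mem_filter.1 hO).1
      have h3 : ((d.1ᶜ \ O) ∪ d.1)ᶜ = O := third_of_mk hOW
      unfold specRow rbVec
      simp only
      rw [if_true, if_neg hS0, h3, if_neg (fun h => hS0 h.1), if_pos hcond, zero_add]
      ring
    · refine sum_eq_zero fun O _ => ?_
      unfold rbVec
      simp only
      rw [if_neg (fun h => hS0 h.1), if_neg hcond, zero_add, mul_zero]

/-! ## The typed conjecture and the reduction -/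

/-- **RAINBOW KERNEL INDEPENDENCE** (this work; OPEN, census-clean — see the file header): for every sunflower, the two-stage rainbow
vectors `rbVec ρ ∈ GF(2)^{sup}` (`ρ` a rainbow) are linearly independent.  An obligation, never a fact: use as
`(h : RainbowKernelIndependence)`. [status: open] -/
@[conjecture] def _root_.Summit.CriticalPhenomena.PercolationContinuityZ3.Theorems.SunflowerPartition.RainbowKernelIndependence : Prop :=
  ∀ (α : Type) [Fintype α] [DecidableEq α] (F : Sunflower α),
    LinearIndependent (ZMod 2)
      (fun ρ : ↥(F.dem.filter (fun d => F.IsRainbow d)) => fun σ : ↥F.sup => F.rbVec ρ.1 σ.1)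

end Sunflower

/-- **`RainbowKernelIndependence → PartitionLemmaH`** (this work).  Rank–nullity in `GF(2)^{sup}`: the spectator-row map
`v ↦ (⟨specRow d, v⟩)_d` has rank `#{non-rainbow demands}` (its rows are independent, `specRows_indep`), the span of the rainbow vectors has
dimension `#{rainbows}` (hypothesis) and lies in its kernel (`rbVec_orth`); hence `#dem ≤ #sup`, i.e. `0 ≤ ZH = 6(#sup − #dem)`. [this work] -/
theorem partitionLemmaH_of_rainbowKernelIndependence (h : RainbowKernelIndependence) : PartitionLemmaH := by
  intro α _ _ F
  classical
  set SP := F.dem.filter (fun d => ¬ F.IsRainbow d) with hSP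
  set RB := F.dem.filter (fun d => F.IsRainbow d) with hRB
  have hli := h α F
  let R : Matrix ↥SP ↥F.sup (ZMod 2) := Matrix.of fun d σ => F.specRow d.1 σ.1
  -- (1) the rows of `R` are independent
  have hinj : Function.Injective (Matrix.mulVecLin R.transpose) := by
    rw [← LinearMap.ker_eq_bot, LinearMap.ker_eq_bot']
    intro g hg
    let c : Finset α × Finset α → ZMod 2 := fun d => if hd : d ∈ SP then g ⟨d, hd⟩ else 0
    have hc : ∀ σ ∈ F.sup, (∑ d ∈ SP, c d * F.specRow d σ) = 0 := by
      intro σ hσ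
      have h0 : (R.transpose.mulVec g) ⟨σ, hσ⟩ = 0 :=
        congrFun (show R.transpose.mulVec g = 0 from (Matrix.mulVecLin_apply R.transpose g).symm.trans hg) ⟨σ, hσ⟩
      simp only [Matrix.mulVec, dotProduct, Matrix.transpose_apply, R, Matrix.of_apply] at h0
      rw [← Finset.sum_coe_sort SP]
      refine Eq.trans (sum_congr rfl fun x _ => ?_) h0
      simp only [c, dif_pos x.2]
      ring
    have hz := F.specRows_indep c hc
    funext x
    have := hz x.1 x.2
    simp only [c, dif_pos x.2] at this
    rw [this, Pi.zero_apply]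
  -- (2) rank of the row map
  have hrank : Module.finrank (ZMod 2) (LinearMap.range (Matrix.mulVecLin R)) = Fintype.card ↥SP := by
    have h1 : R.rank = R.transpose.rank := (Matrix.rank_transpose R).symm
    unfold Matrix.rank at h1
    rw [h1, LinearMap.finrank_range_of_inj hinj, Module.finrank_fintype_fun_eq_card]
  -- (3) the rainbow vectors lie in the kernel
  have hker : Submodule.span (ZMod 2) (Set.range (fun ρ : ↥RB => fun σ : ↥F.sup => F.rbVec ρ.1 σ.1))
      ≤ LinearMap.ker (Matrix.mulVecLin R) := by
    rw [Submodule.span_le]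
    rintro v ⟨ρ, rfl⟩
    rw [SetLike.mem_coe, LinearMap.mem_ker, Matrix.mulVecLin_apply]
    funext d
    simp only [Matrix.mulVec, dotProduct, R, Matrix.of_apply, Pi.zero_apply]
    have := F.rbVec_orth (mem_filter.1 ρ.2).1 (mem_filter.1 ρ.2).2 (mem_filter.1 d.2).1 (mem_filter.1 d.2).2
    rw [← Finset.sum_coe_sort F.sup] at this
    exact this
  -- (4) count dimensions
  have hT : Module.finrank (ZMod 2)
      (Submodule.span (ZMod 2) (Set.range (fun ρ : ↥RB => fun σ : ↥F.sup => F.rbVec ρ.1 σ.1))) = Fintype.card ↥RB :=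
    finrank_span_eq_card hli
  have hrn := LinearMap.finrank_range_add_finrank_ker (Matrix.mulVecLin R)
  rw [Module.finrank_fintype_fun_eq_card, hrank] at hrn
  have hle := Submodule.finrank_mono hker
  rw [hT] at hle
  have hcards : Fintype.card ↥SP + Fintype.card ↥RB ≤ Fintype.card ↥F.sup := by omega
  rw [Fintype.card_coe, Fintype.card_coe, Fintype.card_coe] at hcards
  have hdem : F.dem.card = SP.card + RB.card := by
    rw [hSP, hRB, add_comm]; exact (Finset.card_filter_add_card_filter_not _).symm
  rw [F.ZH_eq_six_card_sup_sub_dem]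
  have : (F.dem.card : ℤ) ≤ (F.sup.card : ℤ) := by exact_mod_cast (hdem ▸ hcards)
  linarith

end Summit.CriticalPhenomena.PercolationContinuityZ3.Theorems.SunflowerPartition
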